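import Summits.BirchSwinnertonDyer.Rank1Residual.X11b.AnticyclotomicLowerLinks
import HarnessLib

/-!
# X11b, route p2 — STEP L with every symbol a tree object at CLASSICAL HEEGNER fields (every `ℓ ∣ N`
# split), the data of the sibling sub-cell's whole-class theorem

HONEST FRAMING (cell `b2b-bsdres`, run/shared/lean/b2b/bsd-rank1-residual/, verbatim in every
file): the goal of the cell is to DELETE the COMBINATION-SHAPED residual classes of the
Birch–Swinnerton-Dyer formula for ALL analytic-rank `≤ 1` elliptic curves over `ℚ` — "full BSD
formula for every rank `≤ 1` curve in class `C`" assembled STRICTLY from published theorems — so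
that the rank-`≤ 1` remainder becomes exactly the CONSTRUCTION-SHAPED classes, which are TYPED
(missing-input `Prop`s), NOT attempted. This is not "finishing BSD". Sub-cell
`b2b-bsdres-multr1-p1` (X11b, route R1), serving the sibling route p2 (`BDPRouteLinks.lean`,
`BDPRouteWholeClass.lean`, multr1-p2); RESEARCH ROUTES; no claim beyond the stated class; X11b stays
CONSTRUCTION-SHAPED; nothing here changes a label. THEOREMS ONLY (no definition, no named fact,
no `sorry`).

## Content

`AnticyclotomicLowerLinks.lean` derives multr1-p2's STEP L (`IndexLowerBoundAt`) from the
tree-object links (IMC≥∘BDP)ᵗ + (CTL)ᵗ at ERRATUM fields (one ramified non-split `q`), where the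
Tamagawa step is `padicValNat_tamagawaProductSplit_eq_of_isErratumField`. multr1-p2's own data are
CLASSICAL HEEGNER fields — `SatisfiesHeegnerHypothesis N_E K`: every prime of `N_E` splits in `K` —
for which the Tamagawa step is the same theorem with a VACUOUS bad-prime hypothesis (there is no
non-split bad prime), and the transport value `ord_p ∏_w c_w(E/K) = 2·ord_p ∏_ℓ c_ℓ(E)` is the
sibling's `padicValNat_tamagawaProduct_baseChange_of_heegner` (JSW17 (eq:tamK)). Hence:

* `padicValNat_tamagawaProductSplit_eq_of_heegner` — (TAM) at a Heegner field:
  `ord_p ∏_{w∣N⁺} c_w(E/K) = ord_p ∏_w c_w(E/K)` (`N⁺ = N`).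
* **`indexLowerBoundAt_of_onTreeLowerLinks_of_heegner`** — for `W/ℚ` globally minimal elliptic,
  `p ≥ 5`, `K` imaginary quadratic with the Heegner hypothesis for `N_E`, `Ш(E/K)` finite, and the
  tree-object links (IMC≥∘BDP)ᵗ [OPEN] and (CTL)ᵗ [PUB shape] at one `(κ, γ, 𝔭, ι)`:
  `IndexLowerBoundAt W p K P` — the hypothesis `hL` of multr1-p2's `bsdp_of_classX11b_five_of_typedInputs`
  AT THAT DATUM, with every symbol of its antecedents a tree object.
* `two_mul_index_le_of_onTreeLowerLinks_of_heegner` — the shadow-free inequality with the total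
  Tamagawa product over `K`.

CONDITIONAL on the open link; deletes nothing; no label change.

References: [JetchevSkinnerWan2017] §7.3.1 (eq:tamK), §7.4.1 (eq:shalowerK-1) (arXiv:1512.06894
p. 30); [Castella2018] (1.1), Thm. 2.3, Thm. 3.2.
-/

noncomputable section

open scoped Classical

open WeierstrassCurve NumberField IsDedekindDomain Literature.NumberTheory.EllipticCurves
  Literature.NumberTheory.EllipticCurves.Rank1Residual
  Summit.BirchSwinnertonDyer.Rank1Residual.X11b.AcSelmer

namespace Summit.BirchSwinnertonDyer.Rank1Residual.X11b

section Heegner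

variable (W : WeierstrassCurve ℚ) [W.IsElliptic] [W.IsGloballyMinimal] (p : ℕ) [Fact p.Prime]
  (K : Type) [Field K] [NumberField K]

/-- **(TAM) at a classical Heegner field**: if every prime of `N_E` splits in the imaginary
quadratic `K`, then `ord_p ∏_{w∣N⁺} c_w(E/K) = ord_p ∏_w c_w(E/K)` (`p ≥ 5`; the bad-prime
hypothesis of `padicValNat_tamagawaProductSplit_eq` is vacuous). [cite: JetchevSkinnerWan2017, §7.3.1 (eq:tamK)]
[cite: Castella2018, Thm. 2.3 (arXiv:1704.06608 p. 5), the term ∏_{w∣N⁺}] -/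
theorem padicValNat_tamagawaProductSplit_eq_of_heegner (hp : 5 ≤ p) (hK : IsImaginaryQuadratic K)
    {N : ℕ} (hN : W.conductorNorm ℤ = N) (hH : SatisfiesHeegnerHypothesis N K) :
    padicValNat p (tamagawaProductSplit W K) = padicValNat p (W.baseChange K).tamagawaProduct :=
  padicValNat_tamagawaProductSplit_eq W p K hp hK.1
    (fun ℓ _ hℓN hns ↦ (hns (hH ℓ Fact.out (hN ▸ hℓN))).elim)

variable {W p K}

/-- **STEP L at a classical Heegner datum from the tree-object links** — the hypothesis `hL` of
multr1-p2's whole-class theorem (`BDPRouteWholeClass.bsdp_of_classX11b_five_of_typedInputs`) at the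
datum: for `p ≥ 5`, `K` imaginary quadratic with the Heegner hypothesis for `N_E`, `Ш(E/K)` finite
(Kolyvagin at a non-torsion Heegner point), the OPEN (IMC≥∘BDP)ᵗ and the PUB-shaped (CTL)ᵗ at one
`(κ, γ, 𝔭, ι)` give `IndexLowerBoundAt W p K P`. The Tamagawa step and the transport value are
theorems (`padicValNat_tamagawaProductSplit_eq_of_heegner`, the sibling's
`padicValNat_tamagawaProduct_baseChange_of_heegner`). CONDITIONAL on the open link.
[cite: JetchevSkinnerWan2017, §7.4.1 (eq:shalowerK-1) and §7.3.1 (eq:tamK) (arXiv:1512.06894 p. 30)]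
[cite: Castella2018, (1.1) (p. 2), Thm. 2.3, Thm. 3.2] -/
theorem indexLowerBoundAt_of_onTreeLowerLinks_of_heegner (hp : 5 ≤ p) (hK : IsImaginaryQuadratic K)
    {N : ℕ} (hN : W.conductorNorm ℤ = N) (hH : SatisfiesHeegnerHypothesis N K)
    {P : (W.baseChange K).toAffine.Point} [Finite (W.baseChange K).sha]
    {κ : ZpExtension K p} {𝔭 : HeightOneSpectrum (𝓞 K)} {γ : Field.absoluteGaloisGroup K}
    [Fact (κ.IsTopGenerator γ)] {ι : K →+* ℚ_[p]}
    (hIW : IMCLowerWaldspurgerOnTreeAt p κ 𝔭 γ ι P) (hCTL : ControlOnTreeAt p κ 𝔭 γ ι P) :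
    IndexLowerBoundAt W p K P := by
  obtain ⟨n, hn, hle⟩ := hIW
  obtain ⟨n', hn', hne'⟩ := hCTL
  obtain rfl : n = n' := hn.unique hn'
  refine indexLowerBoundAt_of_shadowLinks p
    ⟨n, 2 * (padicLogOrd W p ι P - 1), padicLogOrd W p ι P, padicValNat p (tamagawaProductSplit W K)⟩
    hle rfl hne' ?_ (padicValNat_tamagawaProduct_baseChange_of_heegner W p hp K hK hN hH)
  unfold LambdaAdicShadow.TamagawaAtRamifiedAt
  exact_mod_cast padicValNat_tamagawaProductSplit_eq_of_heegner W p K hp hK hN hH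

/-- The same from route R1's equality-form tree-object link. [cite: JetchevSkinnerWan2017, §7.4.1 (eq:shalowerK-1) (arXiv:1512.06894 p. 30)] -/
theorem indexLowerBoundAt_of_onTreeLinks_of_heegner (hp : 5 ≤ p) (hK : IsImaginaryQuadratic K)
    {N : ℕ} (hN : W.conductorNorm ℤ = N) (hH : SatisfiesHeegnerHypothesis N K)
    {P : (W.baseChange K).toAffine.Point} [Finite (W.baseChange K).sha]
    {κ : ZpExtension K p} {𝔭 : HeightOneSpectrum (𝓞 K)} {γ : Field.absoluteGaloisGroup K}
    [Fact (κ.IsTopGenerator γ)] {ι : K →+* ℚ_[p]}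
    (hIW : IMCWaldspurgerOnTreeAt p κ 𝔭 γ ι P) (hCTL : ControlOnTreeAt p κ 𝔭 γ ι P) :
    IndexLowerBoundAt W p K P :=
  indexLowerBoundAt_of_onTreeLowerLinks_of_heegner hp hK hN hH
    (imcLowerWaldspurgerOnTreeAt_of_imcWaldspurgerOnTreeAt hIW) hCTL

/-- **The shadow-free lower bound with the TOTAL Tamagawa product over a Heegner field**:
`2·ord_p[E(K):ℤP] ≤ ord_p #Ш(E/K)[p^∞] + ord_p ∏_w c_w(E/K)` from the tree-object links (no
finiteness needed; `N⁺ = N`). CONDITIONAL on the open link.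
[cite: JetchevSkinnerWan2017, §7.4.1 (eq:shalowerK-1) (arXiv:1512.06894 p. 30)] -/
theorem two_mul_index_le_of_onTreeLowerLinks_of_heegner (hp : 5 ≤ p) (hK : IsImaginaryQuadratic K)
    {N : ℕ} (hN : W.conductorNorm ℤ = N) (hH : SatisfiesHeegnerHypothesis N K)
    {P : (W.baseChange K).toAffine.Point}
    {κ : ZpExtension K p} {𝔭 : HeightOneSpectrum (𝓞 K)} {γ : Field.absoluteGaloisGroup K}
    [Fact (κ.IsTopGenerator γ)] {ι : K →+* ℚ_[p]}
    (hIW : IMCLowerWaldspurgerOnTreeAt p κ 𝔭 γ ι P) (hCTL : ControlOnTreeAt p κ 𝔭 γ ι P) :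
    2 * (padicValNat p (AddSubgroup.zmultiples P).index : ℤ) ≤
      (padicValNat p (Nat.card (AddCommGroup.primaryComponent (W.baseChange K).sha p)) : ℤ) +
        padicValNat p (W.baseChange K).tamagawaProduct := by
  have h := two_mul_index_le_of_onTreeLowerLinks hIW hCTL
  rw [padicValNat_tamagawaProductSplit_eq_of_heegner W p K hp hK hN hH] at h
  exact h

end Heegner

end Summit.BirchSwinnertonDyer.Rank1Residual.X11b

end
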